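import Mathlib.RingTheory.Localization.FractionRing
import Literature.NumberTheory.Transcendental.KZBallVolume
import Summits.KontsevichZagierPeriods.KontsevichZagierPeriods.Statement
import HarnessLib

/-!
# SoloInformed — the formal period ring has no additive torsion (FACT M)

`KZ.FormalPeriodRing = FormalRep ⧸ relations` is the ring of formal periods of the fixed
Kontsevich–Zagier calculus (`KZRulesAssociator.lean`); the summit `KontsevichZagierPeriods` is
equivalent to injectivity of `KZ.evalP : FormalPeriodRing →+* ℝ` (`KZKernelConjectureForms`).
The printed Conjecture 1 allows only *integer* combinations of moves ("no division by integers is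
a rule", Statement docstring). This file records that the distinction between `ℤ`-, `ℚ`- and
(real-)`ℚ̄`-linear combinations of moves is void:

* `soloInformed_isUnit_natCast` — every non-zero natural number is a **unit** of
  `FormalPeriodRing` (its inverse is the class of the point representation `[pt, 1/n]`; tree:
  `KZ.natCast_add_one_mul_toFormalPeriod_of_unit_constMul_inv`, i.e. integer scaling is integrand
  additivity and `[pt, n] · [pt, 1/n] = [pt, 1]` is a product of representations);
* `soloInformed_noZeroSMulDivisors_nat/_int` — hence `FormalPeriodRing` is torsion-free;
* `soloInformed_mem_relations_of_nsmul_mem` — **if a multiple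
  `n • c` (`n ≠ 0`) of a formal combination is a relation, then `c` itself is a relation**; in
  particular (`soloInformed_equivalent_of_nsmul_sub_mem`) two representations are KZ-equivalent as
  soon as some non-zero multiple of their difference is a combination of moves (the `ℤ`-version
  `mem_relations_of_zsmul_mem` is already in the tree, `HeckeMultiplicityOneTorsionFree.lean`);
* `soloInformed_divisible` — `FormalPeriodRing` is divisible;
* `soloInformedRatAlgebra` — the resulting `ℚ`-algebra structure (universal property of
  `ℚ = Frac ℤ`, `IsLocalization.lift`), with `algebraMap ℚ P q * n = m` for `q = m / n`.

Role on the solo path (residency `solo-KontsevichZagierPeriods-informed`, PLAN.md, THEOREM D):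
the transfer map from Nori/Kontsevich formal periods of pairs to `FormalPeriodRing ⊗ ℚ̄` produces
`ℚ̄`-linear (after taking real and imaginary parts: real-algebraic-linear, then, clearing a common
denominator of the minimal polynomials' coefficients, `ℚ`-linear) combinations of move instances;
this file is the last, purely algebraic step turning "`N • ([r] − [r'])` is a sum of moves" into
`KZ.Equivalent r r'`.

References: M. Kontsevich, D. Zagier, *Periods* (2001), §1.2 (rules, Conjecture 1), §4.1
(the ring structure); A. Huber, S. Müller-Stach, *Periods and Nori Motives* (2017), §13.1.
-/

noncomputable section

open Literature.NumberTheory.Transcendental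

namespace Summit.KontsevichZagierPeriods.KontsevichZagierPeriods.Theorems

/-- `m + 1` is a unit of the formal period ring: `(m + 1) · ⟦[pt, 1/(m+1)]⟧ = 1`.
[Kontsevich–Zagier 2001, §1.2 rule (1), §4.1] [folklore] -/
theorem soloInformed_isUnit_natCast_add_one (m : ℕ) :
    IsUnit ((m : KZ.FormalPeriodRing) + 1) := by
  have hm : IsAlgebraic ℚ ((m : ℝ) + 1) := by exact_mod_cast isAlgebraic_nat (m + 1)
  exact IsUnit.of_mul_eq_one _
    (KZ.natCast_add_one_mul_toFormalPeriod_of_unit_constMul_inv m hm.inv)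

/-- **Every non-zero natural number is a unit of the formal period ring.**
[Kontsevich–Zagier 2001, §4.1] [folklore] -/
theorem soloInformed_isUnit_natCast {n : ℕ} (hn : n ≠ 0) :
    IsUnit (n : KZ.FormalPeriodRing) := by
  obtain ⟨m, rfl⟩ := Nat.exists_eq_succ_of_ne_zero hn
  push_cast
  exact soloInformed_isUnit_natCast_add_one m

/-- Every non-zero integer is a unit of the formal period ring. [folklore] -/
theorem soloInformed_isUnit_intCast {z : ℤ} (hz : z ≠ 0) :
    IsUnit (z : KZ.FormalPeriodRing) := by
  obtain ⟨n, rfl | rfl⟩ := Int.eq_nat_or_neg z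
  · have hn : n ≠ 0 := by exact_mod_cast hz
    simpa using soloInformed_isUnit_natCast hn
  · have hn : n ≠ 0 := by
      rintro rfl; simp at hz
    simpa using (soloInformed_isUnit_natCast hn).neg

/-- Multiplication by a non-zero natural number is injective on the formal period ring.
[folklore] -/
theorem soloInformed_nsmul_right_injective {n : ℕ} (hn : n ≠ 0) :
    Function.Injective fun x : KZ.FormalPeriodRing => n • x := by
  intro x y hxy
  obtain ⟨u, hu⟩ := soloInformed_isUnit_natCast hn
  have h : (u : KZ.FormalPeriodRing) * x = u * y := by simpa [hu, nsmul_eq_mul] using hxy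
  exact (Units.mul_right_inj u).mp h

/-- **The formal period ring is torsion-free** (as an abelian group). [folklore] -/
theorem soloInformed_noZeroSMulDivisors_nat : NoZeroSMulDivisors ℕ KZ.FormalPeriodRing := by
  refine ⟨fun {c x} h => ?_⟩
  by_cases hc : c = 0
  · exact Or.inl hc
  · right
    have h' : c • x = c • (0 : KZ.FormalPeriodRing) := by rw [h, smul_zero]
    exact soloInformed_nsmul_right_injective hc h'

/-- The formal period ring is torsion-free over `ℤ`. [folklore] -/
theorem soloInformed_noZeroSMulDivisors_int : NoZeroSMulDivisors ℤ KZ.FormalPeriodRing := by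
  haveI := soloInformed_noZeroSMulDivisors_nat
  refine ⟨fun {c x} h => ?_⟩
  by_cases hc : c = 0
  · exact Or.inl hc
  · right
    obtain ⟨n, rfl | rfl⟩ := Int.eq_nat_or_neg c
    · rw [natCast_zsmul] at h
      have hn : n ≠ 0 := by exact_mod_cast hc
      exact (smul_eq_zero_iff_right hn).mp h
    · rw [neg_smul, neg_eq_zero, natCast_zsmul] at h
      have hn : n ≠ 0 := by rintro rfl; simp at hc
      exact (smul_eq_zero_iff_right hn).mp h

/-- **FACT M (relations form).** If a non-zero integer multiple `n • c` of a formal combination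
of integral representations is a `ℤ`-combination of moves, then so is `c`: no "division by `n`"
rule is needed in Conjecture 1. [Kontsevich–Zagier 2001, §1.2] [folklore] -/
theorem soloInformed_mem_relations_of_nsmul_mem {c : KZ.FormalRep} {n : ℕ} (hn : n ≠ 0)
    (h : n • c ∈ KZ.relations) : c ∈ KZ.relations := by
  haveI := soloInformed_noZeroSMulDivisors_nat
  rw [← KZ.toFormalPeriod_eq_zero_iff] at h ⊢
  rw [map_nsmul] at h
  exact (smul_eq_zero_iff_right hn).mp h

/-- `n • c ∈ relations ↔ c ∈ relations` for `n ≠ 0`. [folklore] -/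
theorem soloInformed_nsmul_mem_relations_iff {c : KZ.FormalRep} {n : ℕ} (hn : n ≠ 0) :
    n • c ∈ KZ.relations ↔ c ∈ KZ.relations :=
  ⟨soloInformed_mem_relations_of_nsmul_mem hn, fun h => KZ.relations.nsmul_mem h n⟩

/-- **Two representations are KZ-equivalent as soon as a non-zero multiple of their difference is
a combination of moves.** [Kontsevich–Zagier 2001, §1.2 Conjecture 1] [folklore] -/
theorem soloInformed_equivalent_of_nsmul_sub_mem {n m : ℕ} {r : KZ.IntegralRep n}
    {r' : KZ.IntegralRep m} {N : ℕ} (hN : N ≠ 0)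
    (h : N • (KZ.of r - KZ.of r') ∈ KZ.relations) : KZ.Equivalent r r' :=
  soloInformed_mem_relations_of_nsmul_mem hN h

/-- **The formal period ring is divisible**: `n • y = x` is solvable for `n ≠ 0`. [folklore] -/
theorem soloInformed_divisible (x : KZ.FormalPeriodRing) {n : ℕ} (hn : n ≠ 0) :
    ∃ y : KZ.FormalPeriodRing, n • y = x := by
  obtain ⟨u, hu⟩ := soloInformed_isUnit_natCast hn
  refine ⟨(↑u⁻¹ : KZ.FormalPeriodRing) * x, ?_⟩
  rw [nsmul_eq_mul, ← hu, ← mul_assoc, Units.mul_inv, one_mul]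

/-- Every non-zero-divisor of `ℤ` becomes a unit in the formal period ring. [folklore] -/
theorem soloInformed_isUnit_algebraMap_nonZeroDivisors (y : nonZeroDivisors ℤ) :
    IsUnit (algebraMap ℤ KZ.FormalPeriodRing y) := by
  have hy : (y : ℤ) ≠ 0 := nonZeroDivisors.coe_ne_zero y
  simpa using soloInformed_isUnit_intCast hy

/-- **The `ℚ`-algebra structure of the formal period ring** forced by torsion-freeness and
divisibility: the unique ring map `ℚ = Frac ℤ → P` (universal property of the localisation).
[folklore] -/
def soloInformedRatHom : ℚ →+* KZ.FormalPeriodRing :=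
  IsLocalization.lift (M := nonZeroDivisors ℤ) (S := ℚ)
    (g := algebraMap ℤ KZ.FormalPeriodRing) soloInformed_isUnit_algebraMap_nonZeroDivisors

/-- The `ℚ`-algebra structure on the formal period ring. [folklore] -/
@[reducible] def soloInformedRatAlgebra : Algebra ℚ KZ.FormalPeriodRing := (soloInformedRatHom).toAlgebra

/-- The structure map sends an integer to itself. [folklore] -/
theorem soloInformedRatHom_intCast (z : ℤ) : soloInformedRatHom (z : ℚ) = z := by
  have h := IsLocalization.lift_eq (M := nonZeroDivisors ℤ) (S := ℚ)
    (g := algebraMap ℤ KZ.FormalPeriodRing) soloInformed_isUnit_algebraMap_nonZeroDivisors z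
  simp only [soloInformedRatHom, eq_intCast] at h ⊢
  exact h

/-- The structure map on a fraction: `φ(m / n) * n = m`. [folklore] -/
theorem soloInformedRatHom_div_mul (m : ℤ) {n : ℕ} (hn : n ≠ 0) :
    soloInformedRatHom ((m : ℚ) / n) * n = m := by
  have hq : ((m : ℚ) / n) * n = m := by
    field_simp
  have := congrArg soloInformedRatHom hq
  rw [map_mul] at this
  simpa [soloInformedRatHom_intCast, map_natCast] using this

end Summit.KontsevichZagierPeriods.KontsevichZagierPeriods.Theorems
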